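import Literature.AlgebraicGeometry.Motives.MixedHodgeStructureTensorGr
import Literature.AlgebraicGeometry.Motives.MixedHodgeStructureDualGradedPolarizable
import Literature.AlgebraicGeometry.Motives.MixedHodgeStructureInternalHom
import Literature.AlgebraicGeometry.Motives.MixedHodgeStructureTransport
import Literature.AlgebraicGeometry.Motives.MixedHodgeStructureTateTwist
import Literature.AlgebraicGeometry.Motives.MixedHodgeStructureProd
import Literature.AlgebraicGeometry.Motives.HodgeStructureProdPolarization
import Literature.AlgebraicGeometry.Motives.MixedHodgeStructureBounds
import Literature.AlgebraicGeometry.Motives.HodgeStructures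
import Literature.Geometry.Kaehler.ComplexTorusHodgeStructurePolarization
import HarnessLib

/-!
# Graded-polarizable mixed Hodge structures: closure properties

A mixed `ℚ`-Hodge structure `H` is **graded-polarizable** when every pure Hodge structure `Gr^W_k H`
admits a polarization (Carlson 1980, §2(a): "a polarization of `H` is a set of bilinear forms which
polarize the graded pieces individually"; Cattani–El Zein–Griffiths–Lê, Def. 8.1.14 for variations;
the tree's `MixedHodgeStructure.IsGradedPolarizable`).  The mixed Hodge structures of algebraic
geometry are graded-polarizable, and the graded-polarizable ones form the sub-tensor-category of MHS
used for extensions and absolute Hodge cohomology (Carlson 1980, §2; Beilinson 1986).  This file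
collects the closure properties of graded-polarizability which follow from the abelian-category
structure of MHS already in the tree (`Gr^W_k` is an exact functor to pure Hodge structures of weight
`k`: Deligne, *Hodge II*, Thm. 2.3.5 (iv); the tree's `Hom.grMap_injective`, `Hom.grMap_surjective`)
and from the stability of polarizable pure Hodge structures under sub-objects, quotients, duals,
tensor products, direct sums and Tate twists (Deligne, Hodge II, 2.1.15; Voisin I, Lemma 7.26;
Moonen 2017, §2.1; the tree's `IsPolarizable.of_injective`, `IsPolarizable.of_hom_surjective`,
`IsPolarizable.tensor`, `IsPolarizable.prod`, `IsPolarizable.tateTwist`):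

* transport along a linear isomorphism (`IsGradedPolarizable.comapEquiv`,
  `isGradedPolarizable_comapEquiv_iff`);
* quotients: `IsGradedPolarizable.of_surjective` (a surjective morphism of MHS from a
  graded-polarizable MHS has graded-polarizable target), `isGradedPolarizable_iff_of_bijective`,
  `SubMixedHodgeStructure.isGradedPolarizable_quotient`, `Hom.isGradedPolarizable_coker`
  (sub-objects: the tree's `SubMixedHodgeStructure.isGradedPolarizable`);
* pure Hodge structures: the canonical isomorphism `Gr^W_n H₀ ≅ H₀` for a pure `H₀` of weight `n`
  regarded as an MHS (`HodgeStructure.grToSelfHom`, bijective), hence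
  **`HodgeStructure.IsPolarizable.isGradedPolarizable_toMixedHodgeStructure`** (a polarizable pure Hodge
  structure is a graded-polarizable MHS) and `isGradedPolarizable_tate` (`ℚ(j)`);
* direct sums: the canonical isomorphism `Gr^W_k(H₁ ⊕ H₂) ≅ Gr^W_k H₁ ⊕ Gr^W_k H₂` (`prodGrHom`,
  bijective; Cattani et al., Ex. 3.2.23 (2)), hence **`IsGradedPolarizable.prod`**;
* Tate twists: the canonical isomorphism `Gr^W_k(H(j)) ≅ (Gr^W_{k+2j} H)(j)` of Hodge structures of
  weight `k` (`tateTwistGrHom`, bijective; Cattani et al., Ex. 3.2.23 (4)), hence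
  **`IsGradedPolarizable.tateTwist`**, `isGradedPolarizable_tateTwist_iff`;
* internal Hom: **`IsGradedPolarizable.hom`** — `Hom(H₁, H₂) = H₁^∨ ⊗ H₂` transported
  (`MixedHodgeStructure.hom`), with `IsGradedPolarizable.dual` (`MixedHodgeStructureDualGradedPolarizable`)
  and `IsGradedPolarizable.tensor` (`MixedHodgeStructureTensorGr`); one universe, as the latter.

Everything is proved; no named fact is introduced.

## References

* [Carlson1980] J. A. Carlson, Extensions of mixed Hodge structures, Journées de géométrie algébrique
  d'Angers 1979 (1980), §2(a).
* [DeligneHodgeII1971] P. Deligne, Théorie de Hodge II, Publ. Math. IHÉS 40 (1971), 1.1.12, 2.1.15,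
  Thm. 2.3.5.
* [CattaniElZeinGriffithsLe2014] E. Cattani, F. El Zein, P. A. Griffiths, Lê D. T. (eds.), *Hodge
  Theory*, Math. Notes 49 (2014), Ex. 3.2.23 (1), (4) (p. 163), Lemma 3.2.20, Cor. 3.2.21, Def. 8.1.14.
* [Moonen2017FamiliesMotives] B. Moonen, Families of motives and the Mumford–Tate conjecture, Milan
  J. Math. 85 (2017), §2.1 (p. 3).
* [VoisinHodgeI2002] C. Voisin, *Hodge Theory and Complex Algebraic Geometry I*, §7.3.1 Lemma 7.26.
-/

noncomputable section

open scoped TensorProduct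

namespace Literature.AlgebraicGeometry.Motives

universe u v

variable {V : Type u} [AddCommGroup V] [Module ℚ V]
variable {V' : Type v} [AddCommGroup V'] [Module ℚ V']

namespace MixedHodgeStructure

/-! ### Transport along a linear isomorphism -/

/-- **Graded-polarizability is transported along linear isomorphisms**: `H.comapEquiv e` is
graded-polarizable when `H` is (`e : H.comapEquiv e → H` is an injective morphism of MHS,
`Hom.ofEquiv`; `IsGradedPolarizable.of_injective`). [cite: Carlson1980, §2(a)]
[cite: CattaniElZeinGriffithsLe2014, Def. 3.2.16] -/
theorem IsGradedPolarizable.comapEquiv {H : MixedHodgeStructure V'} (h : H.IsGradedPolarizable)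
    (e : V ≃ₗ[ℚ] V') : (H.comapEquiv e).IsGradedPolarizable :=
  h.of_injective (Hom.ofEquiv H e) (Hom.ofEquiv_bijective H e).1

/-- `H.comapEquiv e` is graded-polarizable iff `H` is. [cite: Carlson1980, §2(a)]
[cite: CattaniElZeinGriffithsLe2014, Def. 3.2.16] -/
theorem isGradedPolarizable_comapEquiv_iff (H : MixedHodgeStructure V') (e : V ≃ₗ[ℚ] V') :
    (H.comapEquiv e).IsGradedPolarizable ↔ H.IsGradedPolarizable :=
  ⟨fun h => h.of_injective (Hom.ofEquivSymm H e) (Hom.ofEquivSymm_bijective H e).1,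
    fun h => h.comapEquiv e⟩

/-! ### Quotients -/

/-- **Graded-polarizability passes to quotients**: if `f : H₁ → H₂` is a surjective morphism of MHS
(`V` finite-dimensional) and `H₁` is graded-polarizable, so is `H₂` — `Gr^W_k f` is surjective
(exactness of `Gr^W_k`, Deligne Thm. 2.3.5 (iv); the tree's `Hom.grMap_surjective`) and a quotient of a
polarizable Hodge structure is polarizable (Deligne 2.1.15; the tree's `IsPolarizable.of_hom_surjective`).
[cite: DeligneHodgeII1971, Thm. 2.3.5 and 2.1.15] [cite: Carlson1980, §2(a)] -/
theorem IsGradedPolarizable.of_surjective [FiniteDimensional ℚ V] {H₁ : MixedHodgeStructure V}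
    {H₂ : MixedHodgeStructure V'} (h : H₁.IsGradedPolarizable) (f : Hom H₁ H₂)
    (hf : Function.Surjective f.toLinearMap) : H₂.IsGradedPolarizable :=
  fun k => (h k).of_hom_surjective (f.gr k) (f.grMap_surjective hf k)

/-- Graded-polarizability is invariant under isomorphisms of MHS. [cite: Carlson1980, §2(a)] -/
theorem isGradedPolarizable_iff_of_bijective [FiniteDimensional ℚ V] {H₁ : MixedHodgeStructure V}
    {H₂ : MixedHodgeStructure V'} (f : Hom H₁ H₂) (hf : Function.Bijective f.toLinearMap) :
    H₁.IsGradedPolarizable ↔ H₂.IsGradedPolarizable :=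
  ⟨fun h => h.of_surjective f hf.2, fun h => h.of_injective f hf.1⟩

/-- The quotient `H / S` of a graded-polarizable MHS by a sub-MHS is graded-polarizable.
[cite: DeligneHodgeII1971, Thm. 2.3.5 and 2.1.15] [cite: Carlson1980, §2(a)] -/
theorem SubMixedHodgeStructure.isGradedPolarizable_quotient [FiniteDimensional ℚ V]
    {H : MixedHodgeStructure V} (S : SubMixedHodgeStructure H) (h : H.IsGradedPolarizable) :
    S.quotient.IsGradedPolarizable :=
  h.of_surjective S.mkQ (Submodule.mkQ_surjective _)

/-- The cokernel of a morphism of MHS with graded-polarizable target is graded-polarizable.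
[cite: DeligneHodgeII1971, Thm. 2.3.5 and 2.1.15] [cite: Carlson1980, §2(a)] -/
theorem Hom.isGradedPolarizable_coker [FiniteDimensional ℚ V'] {H₁ : MixedHodgeStructure V}
    {H₂ : MixedHodgeStructure V'} (f : Hom H₁ H₂) (h : H₂.IsGradedPolarizable) :
    f.coker.IsGradedPolarizable :=
  h.of_surjective f.cokerMkQ (Submodule.mkQ_surjective _)

end MixedHodgeStructure

/-! ### Pure Hodge structures are graded-polarizable mixed Hodge structures -/

namespace HodgeStructure

open MixedHodgeStructure

variable {n : ℤ} (H₀ : HodgeStructure V n)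

/-- **`Gr^W_n H₀ → H₀`, `[v] ↦ v`**, for a pure Hodge structure `H₀` of weight `n` regarded as a mixed
Hodge structure (trivial weight filtration `W_{n-1} = 0`, `W_n = V`: Cattani et al., Ex. 3.2.23 (1)
"A Hodge structure `H` of weight `n` is a mixed Hodge structure with trivial weight filtration"):
the map `W_n / W_{n-1} = V / 0 → V`, a morphism of Hodge structures of weight `n` (the induced filtration
on `Gr^W_n` is `F` itself). [cite: CattaniElZeinGriffithsLe2014, Ex. 3.2.23 (1), p. 163] -/
def grToSelfHom : Hom (H₀.toMixedHodgeStructure.gr n) H₀ where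
  toLinearMap := (subPiece H₀.toMixedHodgeStructure.W n).liftQ (H₀.toMixedHodgeStructure.W n).subtype
    fun x hx => by
      rw [LinearMap.mem_ker, Submodule.subtype_apply]
      have hx' : (x : V) ∈ H₀.toMixedHodgeStructure.W (n - 1) := hx
      rwa [toMixedHodgeStructure_W, trivialWeightFiltration_of_lt (sub_one_lt n), Submodule.mem_bot] at hx'
  map_F_le p := by
    rintro _ ⟨ξ, hξ, rfl⟩
    rw [SetLike.mem_coe, MixedHodgeStructure.gr_F, MixedHodgeStructure.grF, Submodule.mem_map] at hξ
    obtain ⟨η, hη, rfl⟩ := hξ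
    rw [Submodule.mem_comap, toMixedHodgeStructure_F] at hη
    rw [grProj, ← LinearMap.comp_apply, ← LinearMap.baseChange_comp, Submodule.liftQ_mkQ]
    exact hη

/-- `grToSelfHom [v] = v`. [cite: CattaniElZeinGriffithsLe2014, Ex. 3.2.23 (1), p. 163] -/
@[simp]
theorem grToSelfHom_toLinearMap_mk (v : H₀.toMixedHodgeStructure.W n) :
    (grToSelfHom H₀).toLinearMap (Submodule.Quotient.mk v) = (v : V) :=
  rfl

/-- **`Gr^W_n H₀ ≅ H₀`**: `grToSelfHom` is bijective (`W_{n-1} = 0`, `W_n = V`).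
[cite: CattaniElZeinGriffithsLe2014, Ex. 3.2.23 (1), p. 163] -/
theorem grToSelfHom_bijective : Function.Bijective (grToSelfHom H₀).toLinearMap := by
  constructor
  · rw [← LinearMap.ker_eq_bot]
    exact Submodule.ker_liftQ_eq_bot _ _ _ (by rw [Submodule.ker_subtype]; exact bot_le)
  · intro v
    exact ⟨Submodule.Quotient.mk ⟨v, by
      rw [toMixedHodgeStructure_W, trivialWeightFiltration_of_le le_rfl]; exact Submodule.mem_top⟩, rfl⟩

/-- **A polarizable pure Hodge structure is a graded-polarizable mixed Hodge structure**:
`Gr^W_n H₀ ≅ H₀` is polarizable (`IsPolarizable.of_injective` along `grToSelfHom`) and the other graded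
pieces vanish (a Hodge structure on the zero space is polarizable). [cite: Carlson1980, §2(a)]
[cite: CattaniElZeinGriffithsLe2014, Ex. 3.2.23 (1), p. 163] -/
theorem IsPolarizable.isGradedPolarizable_toMixedHodgeStructure (h : H₀.IsPolarizable) :
    H₀.toMixedHodgeStructure.IsGradedPolarizable := by
  intro k
  by_cases hk : k = n
  · subst hk
    exact h.of_injective (grToSelfHom H₀) (grToSelfHom_bijective H₀).1
  · haveI := subsingleton_grW_toMixedHodgeStructure H₀ hk
    exact isPolarizable_of_subsingleton _

/-- **The Tate structure `ℚ(j)` is a graded-polarizable mixed Hodge structure.**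
[cite: DeligneHodgeII1971, 2.1.13–2.1.15] [cite: Carlson1980, §2(a)] -/
theorem isGradedPolarizable_tate (j : ℤ) : (tate j).toMixedHodgeStructure.IsGradedPolarizable :=
  (isPolarizable_tate j).isGradedPolarizable_toMixedHodgeStructure

end HodgeStructure

namespace MixedHodgeStructure

/-! ### Tate twists: `Gr^W_k(H(j)) ≅ (Gr^W_{k+2j} H)(j)` -/

variable (H : MixedHodgeStructure V)

/-- **`Gr^W_k(H(j)) → Gr^W_{k+2j}(H)`**, the identity of `W_k H(j) = W_{k+2j} H` modulo
`W_{k-1} H(j) = W_{k+2j-1} H` (Cattani et al., Ex. 3.2.23 (4): `W_r H(m) := W_{r+2m} H`).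
[cite: CattaniElZeinGriffithsLe2014, Ex. 3.2.23 (4), p. 163] -/
def tateTwistGrMap (j k : ℤ) : grW (H.tateTwist j).W k →ₗ[ℚ] grW H.W (k + 2 * j) :=
  Submodule.mapQ (subPiece (H.tateTwist j).W k) (subPiece H.W (k + 2 * j))
    (Submodule.inclusion (H.tateTwist_W j k).le) fun x hx => by
      have hx' : (x : V) ∈ H.W (k - 1 + 2 * j) := hx
      change (x : V) ∈ H.W (k + 2 * j - 1)
      rwa [show k - 1 + 2 * j = k + 2 * j - 1 by ring] at hx'

/-- `tateTwistGrMap [x] = [x]`. [cite: CattaniElZeinGriffithsLe2014, Ex. 3.2.23 (4), p. 163] -/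
@[simp]
theorem tateTwistGrMap_mk (j k : ℤ) (x : (H.tateTwist j).W k) :
    tateTwistGrMap H j k (Submodule.Quotient.mk x) =
      Submodule.Quotient.mk (Submodule.inclusion (H.tateTwist_W j k).le x) :=
  rfl

/-- `tateTwistGrMap` is bijective. [cite: CattaniElZeinGriffithsLe2014, Ex. 3.2.23 (4), p. 163] -/
theorem tateTwistGrMap_bijective (j k : ℤ) : Function.Bijective (tateTwistGrMap H j k) := by
  constructor
  · rw [injective_iff_map_eq_zero]
    intro a ha
    induction a using Submodule.Quotient.induction_on with
    | _ a =>
      rw [tateTwistGrMap_mk, Submodule.Quotient.mk_eq_zero] at ha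
      rw [Submodule.Quotient.mk_eq_zero]
      have ha' : (a : V) ∈ H.W (k + 2 * j - 1) := ha
      change (a : V) ∈ H.W (k - 1 + 2 * j)
      rwa [show k + 2 * j - 1 = k - 1 + 2 * j by ring] at ha'
  · intro b
    induction b using Submodule.Quotient.induction_on with
    | _ b =>
      refine ⟨Submodule.Quotient.mk ⟨(b : V), ?_⟩, ?_⟩
      · rw [tateTwist_W]
        exact b.2
      · rw [tateTwistGrMap_mk]
        rfl

/-- **`Gr^W_k(H(j)) ≅ (Gr^W_{k+2j} H)(j)` as Hodge structures of weight `k`**: `tateTwistGrMap` is a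
morphism of Hodge structures onto the pure twist `(Gr^W_{k+2j} H)(j)` (weight `k + 2j - 2j` transported to
`k`) — the induced filtration on `Gr^W_k(H(j))` is `F^{•+j}` induced on `Gr^W_{k+2j} H` (Cattani et al.,
Ex. 3.2.23 (4): `F^r H(m) := F^{r+m} H`; the tree's docstring of `MixedHodgeStructure.tateTwist`: "the
graded piece `Gr^W_k H(j)` is `(Gr^W_{k+2j} H)(j)`"). [cite: CattaniElZeinGriffithsLe2014, Ex. 3.2.23 (4), p. 163] -/
def tateTwistGrHom (j k : ℤ) :
    HodgeStructure.Hom ((H.tateTwist j).gr k) (((H.gr (k + 2 * j)).tateTwist j).cast (by ring)) where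
  toLinearMap := tateTwistGrMap H j k
  map_F_le p := by
    rintro _ ⟨ξ, hξ, rfl⟩
    rw [SetLike.mem_coe, gr_F, grF, Submodule.mem_map] at hξ
    obtain ⟨η, hη, rfl⟩ := hξ
    rw [Submodule.mem_comap, tateTwist_F] at hη
    rw [HodgeStructure.cast_F, HodgeStructure.tateTwist_F, gr_F, grF]
    refine ⟨(Submodule.inclusion (H.tateTwist_W j k).le).baseChange ℂ η, ?_, ?_⟩
    · rw [SetLike.mem_coe, Submodule.mem_comap, grIncl, ← LinearMap.comp_apply, ← LinearMap.baseChange_comp,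
        Submodule.subtype_comp_inclusion]
      exact hη
    · rw [grProj, grProj, ← LinearMap.comp_apply, ← LinearMap.comp_apply, ← LinearMap.baseChange_comp,
        ← LinearMap.baseChange_comp, tateTwistGrMap, Submodule.mapQ_mkQ]

/-- The underlying map of `tateTwistGrHom`. [cite: CattaniElZeinGriffithsLe2014, Ex. 3.2.23 (4), p. 163] -/
@[simp]
theorem tateTwistGrHom_toLinearMap (j k : ℤ) : (tateTwistGrHom H j k).toLinearMap = tateTwistGrMap H j k :=
  rfl

/-- **`Gr^W_k(H(j))` is polarizable when `Gr^W_{k+2j} H` is** (polarizations twist: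
`IsPolarizable.tateTwist`; `tateTwistGrHom` is injective). [cite: DeligneHodgeII1971, 2.1.15]
[cite: CattaniElZeinGriffithsLe2014, Ex. 3.2.23 (4), p. 163] -/
theorem isPolarizable_gr_tateTwist (j k : ℤ) (h : (H.gr (k + 2 * j)).IsPolarizable) :
    ((H.tateTwist j).gr k).IsPolarizable :=
  ((h.tateTwist j).cast _).of_injective (tateTwistGrHom H j k) (tateTwistGrMap_bijective H j k).1

/-- **The Tate twist of a graded-polarizable MHS is graded-polarizable.** [cite: DeligneHodgeII1971, 2.1.15]
[cite: Carlson1980, §2(a)] -/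
theorem IsGradedPolarizable.tateTwist {H : MixedHodgeStructure V} (h : H.IsGradedPolarizable) (j : ℤ) :
    (H.tateTwist j).IsGradedPolarizable :=
  fun k => isPolarizable_gr_tateTwist H j k (h _)

/-- `H(j)` is graded-polarizable iff `H` is (`H = H(j)(-j)`). [cite: DeligneHodgeII1971, 2.1.15]
[cite: Carlson1980, §2(a)] -/
theorem isGradedPolarizable_tateTwist_iff (j : ℤ) :
    (H.tateTwist j).IsGradedPolarizable ↔ H.IsGradedPolarizable := by
  refine ⟨fun h => ?_, fun h => h.tateTwist j⟩
  have h' := h.tateTwist (-j)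
  rwa [tateTwist_tateTwist, add_neg_cancel, tateTwist_zero] at h'

/-! ### Direct sums: `Gr^W_k(H₁ ⊕ H₂) ≅ Gr^W_k H₁ ⊕ Gr^W_k H₂` -/

/-- `prodEquiv ((f, g)_ℂ z) = (f_ℂ z, g_ℂ z)`. [folklore] -/
private theorem prodEquiv_prod_baseChange {V₀ : Type*} [AddCommGroup V₀] [Module ℚ V₀] (f : V₀ →ₗ[ℚ] V)
    (g : V₀ →ₗ[ℚ] V') (z : ℂ ⊗[ℚ] V₀) :
    HodgeStructure.prodEquiv V V' ((LinearMap.prod f g).baseChange ℂ z) = (f.baseChange ℂ z, g.baseChange ℂ z) := by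
  induction z using TensorProduct.induction_on with
  | zero => simp only [map_zero]; rfl
  | tmul c v => simp [HodgeStructure.prodEquiv]
  | add x y hx hy => simp only [map_add, hx, hy, Prod.mk_add_mk]

variable (H₁ : MixedHodgeStructure V) (H₂ : MixedHodgeStructure V')

/-- **`Gr^W_k(H₁ ⊕ H₂) → Gr^W_k H₁ ⊕ Gr^W_k H₂`, `[w] ↦ ([w₁], [w₂])`** — the morphism of Hodge structures of
weight `k` with components `Gr^W_k` of the projections (`W_k(H₁ ⊕ H₂) = W_k H₁ ⊕ W_k H₂`, Cattani et al.,
Ex. 3.2.23 (2); `Gr^W_k` is an additive functor, Deligne Thm. 2.3.5). [cite: CattaniElZeinGriffithsLe2014, Ex. 3.2.23 (2), p. 163]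
[cite: DeligneHodgeII1971, Thm. 2.3.5] -/
def prodGrHom (k : ℤ) : HodgeStructure.Hom ((H₁.prod H₂).gr k) ((H₁.gr k).prod (H₂.gr k)) where
  toLinearMap := LinearMap.prod ((Hom.fst H₁ H₂).grMap k) ((Hom.snd H₁ H₂).grMap k)
  map_F_le p := by
    rintro _ ⟨ξ, hξ, rfl⟩
    rw [SetLike.mem_coe] at hξ
    rw [HodgeStructure.prod_F, Submodule.mem_comap, LinearEquiv.coe_coe, prodEquiv_prod_baseChange,
      Submodule.mem_prod]
    exact ⟨((Hom.fst H₁ H₂).gr k).map_F_le p ⟨ξ, hξ, rfl⟩, ((Hom.snd H₁ H₂).gr k).map_F_le p ⟨ξ, hξ, rfl⟩⟩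

/-- `prodGrHom [w] = ([w₁], [w₂])`. [cite: CattaniElZeinGriffithsLe2014, Ex. 3.2.23 (2), p. 163] -/
theorem prodGrHom_toLinearMap_mk (k : ℤ) (w : (H₁.prod H₂).W k) :
    (prodGrHom H₁ H₂ k).toLinearMap (Submodule.Quotient.mk w) =
      (Submodule.Quotient.mk ((Hom.fst H₁ H₂).restrictW k w), Submodule.Quotient.mk ((Hom.snd H₁ H₂).restrictW k w)) :=
  rfl

/-- **`Gr^W_k(H₁ ⊕ H₂) ≅ Gr^W_k H₁ ⊕ Gr^W_k H₂`**: `prodGrHom` is bijective (`W_k`, `W_{k-1}` of the sum are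
the products). [cite: CattaniElZeinGriffithsLe2014, Ex. 3.2.23 (2), p. 163] [cite: DeligneHodgeII1971, Thm. 2.3.5] -/
theorem prodGrHom_bijective (k : ℤ) : Function.Bijective (prodGrHom H₁ H₂ k).toLinearMap := by
  constructor
  · rw [injective_iff_map_eq_zero]
    intro a ha
    induction a using Submodule.Quotient.induction_on with
    | _ w =>
      rw [prodGrHom_toLinearMap_mk, Prod.mk_eq_zero, Submodule.Quotient.mk_eq_zero,
        Submodule.Quotient.mk_eq_zero] at ha
      rw [Submodule.Quotient.mk_eq_zero]
      exact ⟨ha.1, ha.2⟩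
  · rintro ⟨a, b⟩
    induction a using Submodule.Quotient.induction_on with
    | _ a =>
      induction b using Submodule.Quotient.induction_on with
      | _ b =>
        refine ⟨Submodule.Quotient.mk ⟨((a : V), (b : V')), ⟨a.2, b.2⟩⟩, ?_⟩
        rw [prodGrHom_toLinearMap_mk]
        exact Prod.ext (congrArg Submodule.Quotient.mk (Subtype.ext rfl))
          (congrArg Submodule.Quotient.mk (Subtype.ext rfl))

/-- **`Gr^W_k(H₁ ⊕ H₂)` is polarizable when `Gr^W_k H₁` and `Gr^W_k H₂` are** (`IsPolarizable.prod`,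
`prodGrHom` injective). [cite: DeligneHodgeII1971, 2.1.15] [cite: Carlson1980, §2(a)] -/
theorem isPolarizable_gr_prod (k : ℤ) (h₁ : (H₁.gr k).IsPolarizable) (h₂ : (H₂.gr k).IsPolarizable) :
    ((H₁.prod H₂).gr k).IsPolarizable :=
  (h₁.prod h₂).of_injective (prodGrHom H₁ H₂ k) (prodGrHom_bijective H₁ H₂ k).1

/-- **The direct sum of graded-polarizable mixed Hodge structures is graded-polarizable.**
[cite: DeligneHodgeII1971, 2.1.15] [cite: Carlson1980, §2(a)] -/
theorem IsGradedPolarizable.prod {H₁ : MixedHodgeStructure V} {H₂ : MixedHodgeStructure V'}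
    (h₁ : H₁.IsGradedPolarizable) (h₂ : H₂.IsGradedPolarizable) : (H₁.prod H₂).IsGradedPolarizable :=
  fun k => isPolarizable_gr_prod H₁ H₂ k (h₁ k) (h₂ k)

/-! ### Internal Hom -/

/-- **The internal Hom of graded-polarizable mixed Hodge structures is graded-polarizable**:
`Hom(H₁, H₂)` is `H₁^∨ ⊗ H₂` transported along `Hom(V, V') ≅ V^∨ ⊗ V'` (`MixedHodgeStructure.hom`), and
graded-polarizability is preserved by duals (`IsGradedPolarizable.dual`), tensor products
(`IsGradedPolarizable.tensor`, Deligne 1.1.12 with 2.1.15) and transport. One universe, as the tree's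
`IsPolarizable.tensor`. [cite: DeligneHodgeII1971, 1.1.12 and 2.1.15] [cite: Carlson1980, §2(a)]
[cite: Moonen2017FamiliesMotives, §2.1 (p. 3)] -/
theorem IsGradedPolarizable.hom {X : Type u} [AddCommGroup X] [Module ℚ X] [FiniteDimensional ℚ X]
    {X' : Type u} [AddCommGroup X'] [Module ℚ X'] [FiniteDimensional ℚ X'] {K₁ : MixedHodgeStructure X}
    {K₂ : MixedHodgeStructure X'} (h₁ : K₁.IsGradedPolarizable) (h₂ : K₂.IsGradedPolarizable) :
    (hom K₁ K₂).IsGradedPolarizable :=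
  ((IsGradedPolarizable.dual K₁ h₁).tensor h₂).comapEquiv _

end MixedHodgeStructure

end Literature.AlgebraicGeometry.Motives

end
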